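import Summits.QuantumFields.YangMills.Theorems.CovariantDischargeGreenPotentialShell
import HarnessLib

/-!
# `UnitScaleGibbsGreenPotentialMonopoleFarField` — THE MONOPOLE FAR FIELD OF THE FREE GREEN POTENTIAL ON `ℤ³`: `|a|,|γ| ≲ C₁M₀∕N²` AND
# `|∇a|,|∇γ| ≲ C₂M₀∕N³` OFF `box p (N + ℓ)` — NO MEAN-ZERO HYPOTHESIS (the collar sizes of the re-line of LINE 28 «GrossTransfer»;
# crux `UnitScaleTilt.HistoryTailL` stmt-QuantumFields-19936 ∕ `MeanDeviationL` stmt-QuantumFields-23083)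

Cell `ym3-torus` (YM ladder rung R3 = continuum SU(2) Yang–Mills on T³ — a RUNG, NOT the Clay problem: not d = 4, not infinite volume, not a mass gap),
width seat `ym-ust-19936-w2` (gen 15), pen of record of `stub_linTest`.  The objects are those of line «sandwich_discharge» (Z-e)
(✓`CovariantDischargeGreenPotentialShell`): `ω` a 2-form on `ℤ³` supported in `box p ℓ`, `β = (G∕2)∗ω`, `a = δ₂β`, `γ = d₂β`, the free kernel's
first differences `K_e(w) = G(w+e_e) − G(w)` with the box-language decay rows (H1) `|K_e w| ≤ C₁∕n²`, (H2) `|K_e(w+e_i) − K_e w| ≤ C₂∕n³` off `box 0 (n−1)`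
(✓`CovariantDischargeFreeGreenKernelBoxBounds.exists_fdiff_latticeGreen_box_bounds`).  The (Z-e) far-field rows are DIPOLE rows (`12C₂M₁∕N³`) and need
`Σω = 0`; the re-lined `stub_linTest` pairs a NON-mean-zero weight (net flux `(L²)^j`) and the extra `1∕R` comes from `∇χ` instead
(✓`UnitScaleGibbsCollarCoboundary`), so only the MONOPOLE rows are needed: this file.  `M₀ := Σ_{μν}Σ_y|ω(y,μ,ν)|`.
* §1 `abs_sum_mul_le_of_bound` — `|Σ_{y∈box p ℓ} K(x−y)·ω y| ≤ (C∕N^q)·Σ_y|ω y|` when `|K w| ≤ C∕n^q` off `box 0 (n−1)` and `x ∉ box p (N+ℓ−1)` (no cancellation);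
* §2 ★`abs_potential_le_far_monopole` (`|a(x,ν)| ≤ C₁M₀∕(2N²)` for `x ∉ box p (N+ℓ)`), ★`abs_dTwo_le_far_monopole` (`|γ| ≤ 3C₁M₀∕(2N²)`, `x ∉ box p (N+ℓ−1)`),
  ★`abs_fdiff_potential_le_far_monopole` (`|a(x+e_i,ν) − a(x,ν)| ≤ C₂M₀∕(2N³)`), ★`abs_fdiff_dTwo_le_far_monopole` (`|γ(x+e_i) − γ(x)| ≤ 3C₂M₀∕(2N³)`).
HONEST FRAMING.  Finite sums over landed kernel rows; `--supports` helper; proves no stub, crux, rung or summit statement; `stub_linTest`, «ShallowFluxSecondMomentL»,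
(Q), K1, `MeanDeviationL`, `HistoryTailL` are NOT proved; the Yang–Mills mass gap is NOT proved.
References: Lawler, *Intersections of random walks* (1991) Thm 1.5.5 (kernel asymptotics, via lit ✓`LatticeGreenGradient`) [Lawler1991];
[Balaban1984PropagatorsII] (1.9) p. 226.
-/

noncomputable section

set_option autoImplicit false

open scoped BigOperators
open Finset

namespace Summit.QuantumFields.YangMills.Theorems.UnitScaleGibbsGreenPotentialMonopoleFarField

open Literature.Probability.LatticeModels (latticeGreen)
open Literature.MathematicalPhysics.QuantumFieldTheory.Balaban1983to89.B4Eq19LatticeOperators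
open Summit.QuantumFields.YangMills.Theorems.CovariantDischargeMatchedChargeKernelBounds (not_mem_box_zero_of_far)
open Summit.QuantumFields.YangMills.Theorems.CovariantDischargeGreenPotentialShell (potential_eq_conv grad_potential_eq_conv dTwo_eq_conv)

variable {d : ℕ}

/-! ## §1 A convolution against a kernel with a plain sup-norm bound -/

/-- ★ **NO-CANCELLATION FAR FIELD**: if `|K w| ≤ C∕n^q` whenever `w ∉ box 0 (n−1)` (`n ≥ n₀`), then for `x ∉ box p (N+ℓ−1)`, `N ≥ n₀`:
`|Σ_{y ∈ box p ℓ} K(x−y)·ω y| ≤ (C∕N^q)·Σ_{y ∈ box p ℓ} |ω y|`. [folklore] -/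
theorem abs_sum_mul_le_of_bound (K : Zd d → ℝ) {C : ℝ} (q n₀ : ℕ)
    (hK : ∀ (w : Zd d) (n : ℕ), n₀ ≤ n → w ∉ box (0 : Zd d) ((n : ℤ) - 1) → |K w| ≤ C / (n : ℝ) ^ q)
    (ω : Zd d → ℝ) (p : Zd d) (ℓ : ℕ) (x : Zd d) (N : ℕ) (hN : n₀ ≤ N) (hx : x ∉ box p ((N : ℤ) + ℓ - 1)) :
    |∑ y ∈ box p (ℓ : ℤ), K (x - y) * ω y| ≤ C / (N : ℝ) ^ q * ∑ y ∈ box p (ℓ : ℤ), |ω y| := by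
  rw [Finset.mul_sum]
  refine (Finset.abs_sum_le_sum_abs _ _).trans (Finset.sum_le_sum fun y hy => ?_)
  rw [abs_mul]
  refine mul_le_mul_of_nonneg_right ?_ (abs_nonneg _)
  have hw : x - y ∉ box (0 : Zd d) ((N : ℤ) - 1) := by
    have h := not_mem_box_zero_of_far (p := p) (x := x) (w := x - y) (ℓ := (ℓ : ℤ)) (N := (N : ℤ) + ℓ) (by rwa [show (N : ℤ) + ℓ - 1 = (N : ℤ) + ℓ - 1 by ring]) (by rwa [sub_sub_cancel])
    rwa [show (N : ℤ) + ℓ - ℓ - 1 = (N : ℤ) - 1 by ring] at h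
  exact hK (x - y) N hN hw

/-! ## §2 The monopole far-field rows of `a = δ₂β` and `γ = d₂β` (`d = 3`) -/

section FarField

variable {C₁ C₂ : ℝ}
  (hK1 : ∀ (e : Fin 3) (w : Zd 3) (n : ℕ), 1 ≤ n → w ∉ box (0 : Zd 3) ((n : ℤ) - 1) →
    |latticeGreen (w + unitVec e) - latticeGreen w| ≤ C₁ / (n : ℝ) ^ 2)
  (hK2 : ∀ (e : Fin 3) (w : Zd 3) (n : ℕ), 2 ≤ n → w ∉ box (0 : Zd 3) ((n : ℤ) - 1) → ∀ i : Fin 3,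
    |(latticeGreen (w + unitVec i + unitVec e) - latticeGreen (w + unitVec i)) - (latticeGreen (w + unitVec e) - latticeGreen w)| ≤ C₂ / (n : ℝ) ^ 3)
  (ω β : Zd 3 → Fin 3 → Fin 3 → ℝ) (a : Zd 3 → Fin 3 → ℝ) (γ : Zd 3 → Fin 3 → Fin 3 → Fin 3 → ℝ) (p : Zd 3) (ℓ : ℕ)
  (hβ : ∀ x μ ν, β x μ ν = ∑ y ∈ box p ℓ, latticeGreen (x - y) / 2 * ω y μ ν)
  (ha : ∀ x ν, a x ν = ∑ μ, (β (x - unitVec μ) μ ν - β x μ ν))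
  (hγ : ∀ x κ μ ν, γ x κ μ ν = (β (x + unitVec κ) μ ν - β x μ ν) - (β (x + unitVec μ) κ ν - β x κ ν) + (β (x + unitVec ν) κ μ - β x κ μ))

/-- One component's `ℓ¹` mass is at most `M₀`. [folklore] -/
theorem sum_abs_comp_le_total (ω : Zd 3 → Fin 3 → Fin 3 → ℝ) (p : Zd 3) (ℓ : ℕ) (c₁ c₂ : Fin 3) :
    ∑ y ∈ box p (ℓ : ℤ), |ω y c₁ c₂| ≤ ∑ μ, ∑ ν, ∑ y ∈ box p (ℓ : ℤ), |ω y μ ν| := by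
  have h1 : ∑ y ∈ box p (ℓ : ℤ), |ω y c₁ c₂| ≤ ∑ ν, ∑ y ∈ box p (ℓ : ℤ), |ω y c₁ ν| :=
    Finset.single_le_sum (f := fun ν => ∑ y ∈ box p (ℓ : ℤ), |ω y c₁ ν|) (fun ν _ => Finset.sum_nonneg fun _ _ => abs_nonneg _) (Finset.mem_univ c₂)
  have h2 : ∑ ν, ∑ y ∈ box p (ℓ : ℤ), |ω y c₁ ν| ≤ ∑ μ, ∑ ν, ∑ y ∈ box p (ℓ : ℤ), |ω y μ ν| :=
    Finset.single_le_sum (f := fun μ => ∑ ν, ∑ y ∈ box p (ℓ : ℤ), |ω y μ ν|)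
      (fun μ _ => Finset.sum_nonneg fun _ _ => Finset.sum_nonneg fun _ _ => abs_nonneg _) (Finset.mem_univ c₁)
  exact h1.trans h2

include hK1 hβ ha in
/-- ★ **MONOPOLE FAR FIELD OF THE POTENTIAL**: `|a(x,ν)| ≤ (3∕2)·(C₁∕N²)·M₀` for `x ∉ box p (N+ℓ)`, `N ≥ 1`. [folklore] -/
theorem abs_potential_le_far_monopole (hC₁ : 0 ≤ C₁) (x : Zd 3) (ν : Fin 3) (N : ℕ) (hN : 1 ≤ N) (hx : x ∉ box p ((N : ℤ) + ℓ)) :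
    |a x ν| ≤ 3 / 2 * (C₁ / (N : ℝ) ^ 2) * ∑ μ, ∑ ν, ∑ y ∈ box p (ℓ : ℤ), |ω y μ ν| := by
  set M₀ : ℝ := ∑ μ, ∑ ν, ∑ y ∈ box p (ℓ : ℤ), |ω y μ ν| with hM₀
  rw [potential_eq_conv ω β a p ℓ hβ ha x ν, abs_mul, abs_neg, abs_of_pos (by norm_num : (0 : ℝ) < 1 / 2)]
  have hx' : ∀ μ : Fin 3, x - unitVec μ ∉ box p ((N : ℤ) + ℓ - 1) := fun μ =>
    sub_unitVec_not_mem_box (r := (N : ℤ) + ℓ - 1) (by rwa [sub_add_cancel]) μ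
  have hterm : ∀ μ : Fin 3, |∑ y ∈ box p (ℓ : ℤ), (latticeGreen (x - unitVec μ - y + unitVec μ) - latticeGreen (x - unitVec μ - y)) * ω y μ ν|
      ≤ C₁ / (N : ℝ) ^ 2 * M₀ := fun μ => by
    have h := abs_sum_mul_le_of_bound (fun w => latticeGreen (w + unitVec μ) - latticeGreen w) 2 1 (fun w n hn hw => hK1 μ w n hn hw)
      (fun y => ω y μ ν) p ℓ (x - unitVec μ) N hN (hx' μ)
    exact h.trans (mul_le_mul_of_nonneg_left (sum_abs_comp_le_total ω p ℓ μ ν) (by positivity))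
  calc 1 / 2 * |∑ μ, ∑ y ∈ box p (ℓ : ℤ), (latticeGreen (x - unitVec μ - y + unitVec μ) - latticeGreen (x - unitVec μ - y)) * ω y μ ν|
      ≤ 1 / 2 * ∑ μ : Fin 3, C₁ / (N : ℝ) ^ 2 * M₀ :=
        mul_le_mul_of_nonneg_left ((Finset.abs_sum_le_sum_abs _ _).trans (Finset.sum_le_sum fun μ _ => hterm μ)) (by norm_num)
    _ = 3 / 2 * (C₁ / (N : ℝ) ^ 2) * M₀ := by
        simp only [Finset.sum_const, Finset.card_univ, Fintype.card_fin, nsmul_eq_mul]; ring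

include hK2 hβ ha in
/-- ★ **MONOPOLE FAR FIELD OF THE POTENTIAL'S GRADIENT**: `|a(x+e_i,ν) − a(x,ν)| ≤ (3∕2)·(C₂∕N³)·M₀` for `x ∉ box p (N+ℓ)`, `N ≥ 2`. [folklore] -/
theorem abs_fdiff_potential_le_far_monopole (hC₂ : 0 ≤ C₂) (x : Zd 3) (i ν : Fin 3) (N : ℕ) (hN : 2 ≤ N) (hx : x ∉ box p ((N : ℤ) + ℓ)) :
    |a (x + unitVec i) ν - a x ν| ≤ 3 / 2 * (C₂ / (N : ℝ) ^ 3) * ∑ μ, ∑ ν, ∑ y ∈ box p (ℓ : ℤ), |ω y μ ν| := by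
  set M₀ : ℝ := ∑ μ, ∑ ν, ∑ y ∈ box p (ℓ : ℤ), |ω y μ ν| with hM₀
  rw [potential_eq_conv ω β a p ℓ hβ ha (x + unitVec i) ν, potential_eq_conv ω β a p ℓ hβ ha x ν, ← mul_sub, ← Finset.sum_sub_distrib,
    abs_mul, abs_neg, abs_of_pos (by norm_num : (0 : ℝ) < 1 / 2)]
  have hx' : ∀ μ : Fin 3, x - unitVec μ ∉ box p ((N : ℤ) + ℓ - 1) := fun μ =>
    sub_unitVec_not_mem_box (r := (N : ℤ) + ℓ - 1) (by rwa [sub_add_cancel]) μ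
  have hterm : ∀ μ : Fin 3,
      |∑ y ∈ box p (ℓ : ℤ), (latticeGreen (x + unitVec i - unitVec μ - y + unitVec μ) - latticeGreen (x + unitVec i - unitVec μ - y)) * ω y μ ν -
        ∑ y ∈ box p (ℓ : ℤ), (latticeGreen (x - unitVec μ - y + unitVec μ) - latticeGreen (x - unitVec μ - y)) * ω y μ ν| ≤ C₂ / (N : ℝ) ^ 3 * M₀ := by
    intro μ
    rw [← Finset.sum_sub_distrib]
    have e : ∀ y ∈ box p (ℓ : ℤ), (latticeGreen (x + unitVec i - unitVec μ - y + unitVec μ) - latticeGreen (x + unitVec i - unitVec μ - y)) * ω y μ ν -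
        (latticeGreen (x - unitVec μ - y + unitVec μ) - latticeGreen (x - unitVec μ - y)) * ω y μ ν =
        ((latticeGreen ((x - unitVec μ - y) + unitVec i + unitVec μ) - latticeGreen ((x - unitVec μ - y) + unitVec i)) -
          (latticeGreen ((x - unitVec μ - y) + unitVec μ) - latticeGreen (x - unitVec μ - y))) * ω y μ ν := by
      intro y _
      rw [show x + unitVec i - unitVec μ - y + unitVec μ = (x - unitVec μ - y) + unitVec i + unitVec μ by abel,
        show x + unitVec i - unitVec μ - y = (x - unitVec μ - y) + unitVec i by abel]
      ring
    rw [Finset.sum_congr rfl e]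
    have h := abs_sum_mul_le_of_bound
      (fun w => (latticeGreen (w + unitVec i + unitVec μ) - latticeGreen (w + unitVec i)) - (latticeGreen (w + unitVec μ) - latticeGreen w)) 3 2
      (fun w n hn hw => hK2 μ w n hn hw i) (fun y => ω y μ ν) p ℓ (x - unitVec μ) N hN (hx' μ)
    exact h.trans (mul_le_mul_of_nonneg_left (sum_abs_comp_le_total ω p ℓ μ ν) (by positivity))
  calc 1 / 2 * |∑ μ, (∑ y ∈ box p (ℓ : ℤ), (latticeGreen (x + unitVec i - unitVec μ - y + unitVec μ) - latticeGreen (x + unitVec i - unitVec μ - y)) * ω y μ ν -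
        ∑ y ∈ box p (ℓ : ℤ), (latticeGreen (x - unitVec μ - y + unitVec μ) - latticeGreen (x - unitVec μ - y)) * ω y μ ν)|
      ≤ 1 / 2 * ∑ μ : Fin 3, C₂ / (N : ℝ) ^ 3 * M₀ :=
        mul_le_mul_of_nonneg_left ((Finset.abs_sum_le_sum_abs _ _).trans (Finset.sum_le_sum fun μ _ => hterm μ)) (by norm_num)
    _ = 3 / 2 * (C₂ / (N : ℝ) ^ 3) * M₀ := by
        simp only [Finset.sum_const, Finset.card_univ, Fintype.card_fin, nsmul_eq_mul]; ring

include hK1 hβ hγ in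
/-- ★ **MONOPOLE FAR FIELD OF THE CUBE DERIVATIVE**: `|γ(x,κ,μ,ν)| ≤ (3∕2)·(C₁∕N²)·M₀` for `x ∉ box p (N+ℓ−1)`, `N ≥ 1`. [folklore] -/
theorem abs_dTwo_le_far_monopole (hC₁ : 0 ≤ C₁) (x : Zd 3) (κ μ ν : Fin 3) (N : ℕ) (hN : 1 ≤ N) (hx : x ∉ box p ((N : ℤ) + ℓ - 1)) :
    |γ x κ μ ν| ≤ 3 / 2 * (C₁ / (N : ℝ) ^ 2) * ∑ μ, ∑ ν, ∑ y ∈ box p (ℓ : ℤ), |ω y μ ν| := by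
  set M₀ : ℝ := ∑ μ, ∑ ν, ∑ y ∈ box p (ℓ : ℤ), |ω y μ ν| with hM₀
  rw [dTwo_eq_conv ω β γ p ℓ hβ hγ x κ μ ν]
  have hterm : ∀ e c₁ c₂ : Fin 3, |(1 : ℝ) / 2 * ∑ y ∈ box p (ℓ : ℤ), (latticeGreen (x - y + unitVec e) - latticeGreen (x - y)) * ω y c₁ c₂| ≤
      1 / 2 * (C₁ / (N : ℝ) ^ 2 * M₀) := by
    intro e c₁ c₂
    rw [abs_mul, abs_of_pos (by norm_num : (0 : ℝ) < 1 / 2)]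
    refine mul_le_mul_of_nonneg_left ?_ (by norm_num)
    have h := abs_sum_mul_le_of_bound (fun w => latticeGreen (w + unitVec e) - latticeGreen w) 2 1 (fun w n hn hw => hK1 e w n hn hw)
      (fun y => ω y c₁ c₂) p ℓ x N hN hx
    exact h.trans (mul_le_mul_of_nonneg_left (sum_abs_comp_le_total ω p ℓ c₁ c₂) (by positivity))
  have h1 := hterm κ μ ν
  have h2 := hterm μ κ ν
  have h3 := hterm ν κ μ
  rw [abs_le] at h1 h2 h3 ⊢
  constructor <;> linarith [h1.1, h1.2, h2.1, h2.2, h3.1, h3.2]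

include hK2 hβ hγ in
/-- ★ **MONOPOLE FAR FIELD OF THE CUBE DERIVATIVE'S GRADIENT**: `|γ(x+e_i,κ,μ,ν) − γ(x,κ,μ,ν)| ≤ (3∕2)·(C₂∕N³)·M₀` for `x ∉ box p (N+ℓ−1)`, `N ≥ 2`. [folklore] -/
theorem abs_fdiff_dTwo_le_far_monopole (hC₂ : 0 ≤ C₂) (x : Zd 3) (i κ μ ν : Fin 3) (N : ℕ) (hN : 2 ≤ N) (hx : x ∉ box p ((N : ℤ) + ℓ - 1)) :
    |γ (x + unitVec i) κ μ ν - γ x κ μ ν| ≤ 3 / 2 * (C₂ / (N : ℝ) ^ 3) * ∑ μ, ∑ ν, ∑ y ∈ box p (ℓ : ℤ), |ω y μ ν| := by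
  set M₀ : ℝ := ∑ μ, ∑ ν, ∑ y ∈ box p (ℓ : ℤ), |ω y μ ν| with hM₀
  rw [dTwo_eq_conv ω β γ p ℓ hβ hγ (x + unitVec i) κ μ ν, dTwo_eq_conv ω β γ p ℓ hβ hγ x κ μ ν]
  have hterm : ∀ e c₁ c₂ : Fin 3,
      |(1 : ℝ) / 2 * ∑ y ∈ box p (ℓ : ℤ), (latticeGreen (x + unitVec i - y + unitVec e) - latticeGreen (x + unitVec i - y)) * ω y c₁ c₂ -
        (1 : ℝ) / 2 * ∑ y ∈ box p (ℓ : ℤ), (latticeGreen (x - y + unitVec e) - latticeGreen (x - y)) * ω y c₁ c₂| ≤ 1 / 2 * (C₂ / (N : ℝ) ^ 3 * M₀) := by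
    intro e c₁ c₂
    rw [← mul_sub, ← Finset.sum_sub_distrib, abs_mul, abs_of_pos (by norm_num : (0 : ℝ) < 1 / 2)]
    refine mul_le_mul_of_nonneg_left ?_ (by norm_num)
    have eq : ∀ y ∈ box p (ℓ : ℤ), (latticeGreen (x + unitVec i - y + unitVec e) - latticeGreen (x + unitVec i - y)) * ω y c₁ c₂ -
        (latticeGreen (x - y + unitVec e) - latticeGreen (x - y)) * ω y c₁ c₂ =
        ((latticeGreen ((x - y) + unitVec i + unitVec e) - latticeGreen ((x - y) + unitVec i)) - (latticeGreen ((x - y) + unitVec e) - latticeGreen (x - y))) *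
          ω y c₁ c₂ := by
      intro y _
      rw [show x + unitVec i - y + unitVec e = (x - y) + unitVec i + unitVec e by abel, show x + unitVec i - y = (x - y) + unitVec i by abel]
      ring
    rw [Finset.sum_congr rfl eq]
    have h := abs_sum_mul_le_of_bound
      (fun w => (latticeGreen (w + unitVec i + unitVec e) - latticeGreen (w + unitVec i)) - (latticeGreen (w + unitVec e) - latticeGreen w)) 3 2
      (fun w n hn hw => hK2 e w n hn hw i) (fun y => ω y c₁ c₂) p ℓ x N hN hx
    exact h.trans (mul_le_mul_of_nonneg_left (sum_abs_comp_le_total ω p ℓ c₁ c₂) (by positivity))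
  have h1 := hterm κ μ ν
  have h2 := hterm μ κ ν
  have h3 := hterm ν κ μ
  rw [abs_le] at h1 h2 h3 ⊢
  constructor <;> linarith [h1.1, h1.2, h2.1, h2.2, h3.1, h3.2]

end FarField


end Summit.QuantumFields.YangMills.Theorems.UnitScaleGibbsGreenPotentialMonopoleFarField

end
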